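import Summits.QuantumFields.YangMills.Theorems.BalabanUVNodesN07DentBlockDataSmall
import Summits.QuantumFields.YangMills.Theorems.BalabanUVNodesN07CubeTowerInsideRecordBelowTop
import HarnessLib

/-!
# N07 [B11] (= [15] = [Balaban1985Variational]) Sect. F — **THE NEAR DATUM ROWS OF HCHART-MEET-NORM-77 AT THE RECORD, ONE THEOREM**: for EVERY cell `c` of print's (150) family
# `D″ = cubeDomains ⊓ domainsOfSeq Ω` in MODULE 77's near class «top, or BOTH end blocks in the next cube», `‖log 𝒜_{j(c)}(U^u)(c)‖` is δ-linearly small — MODULE 79's three cases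
# dispatched onto MODULE 75's top ∕ dent-pair-crossing rows and MODULE 81's one-block within row, with one common bound

Cell `pub-ymgap`, seat `pub-ymgap-dag-n07-e` g26 (FAN-OUT §N07 row s3; LANE OWNER of the K0 road), MODULE 80 (INTENT-80, cell bus).  `--kind proof --supports stmt-QuantumFields-20541 --as helper`
(K0⁷); count-neutral; def-free; ONE theorem.  [15] = [Balaban1985Variational]; [6] = [Balaban1985RegularSpaces]; [III] = [Balaban1988Convergent]; [4] = [Balaban1984PropagatorsII].

WHY.  HCHART-MEET-NORM-77 (MODULE 77b) asks, for its datum `B`, the near row `‖B c‖ ≤ β₁·(dist + 1)` on the cells of print's near class (160) «`j(c) = k` or both end blocks in `□_{j(c)+1}`».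
MODULE 79 `near_cases_meet_both` says such a cell is a TOP cell or a level-(k−1) DENT PAIR (both end blocks in `□_k ∖ Ω_k`); MODULE 75 serves the top cells (any `Λ_k`-cell) and the
dent-pair CROSSING cells (keys `t, t + e_μ`), MODULE 81 the within-block cells of a single dent block (key `t`).  THIS FILE threads the three by name: the labels `t` come from
`mem_cubeDomains_Om_iff` (`castSite = coverAt`), the target label from `blockOf_shift_or` ∕ `castSite_add_e`, the «off `Γ_k`» keys from «not in `(domainsOfSeq Ω k).Om k`» through
`mem_domainsOfSeq_Om_iff_centre` (nesting + block saturation of the run) and `genSet ⊆ pts Ω_k` — so the chart's assembly takes the near half of its `B`-rows from ONE theorem with ONE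
δ-linear bound (the crossing bound dominates the other two).

WHAT IS PROVED (sorry-free; no definition; axioms standard).  §1 `not_mem_genSet_of_embIter_not_mem` (`1 ≤ j ≤ k`: `embIter j y ∉ Ω_j ⇒ y ∉ Γ_j`), `Icc_collar_of_inBox` ∕
`Icc_collar_add_e_of_inBox` (a label of `□_j^{(j)}` and its face-neighbours lie in the one-collar box).  §2 ★★★ `norm_mlog_shearedAvgIter_le_of_nearBoth_of_data (F N)` — under MODULE 75's
hypotheses (separated run, grid numerics, floor `(11d + 4ρ + Mc)L + 3 ≤ M₁`, ranges with the crossing log-guard on `a₁`, data + fibre, meeting + print-margin-clean datum `(m+1, idx)`,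
`□̃` non-wrapping, `NrmOfRecordWide … u A`, the (2.2) collar of `D″`, `L ≤ ρ`): for EVERY `c : BondIdx D″` in the near class,
`‖log 𝒜_{j(c)}(U^u)(c)‖ ≤ 2·((d−1)·crad·(1+2C_L)·δ_{m+1} + 7·t₂(δ_m) + (d+1)(L−1)·τ_rad(δ_m))`.
HONEST SCOPE.  By-name dispatch; every analytic input is a landed module's (69b″ ∕ 71″ ∕ 72 ∕ 75 ∕ 81) under their displayed hypotheses; `NrmOfRecordWide`'s door is CONDITIONAL (`HThm4Rec`,
n07-w3 S1ᶜ); the FAR rows are MODULE 78's, the `B′` rows and the assembly are NOT here; nothing of [15]∕[6]∕[III]∕[4] ANALYSIS asserted beyond the cited lemmas; K0⁷ ∕ K1⁹ NOT closed; N07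
NOT discharged; counts unmoved (typed 28∕28 · discharged 8∕27 per the chair); one finite 𝕋⁴ programme at fixed ε — the route closes the conditional finite-𝕋⁴ rung `BalabanLadder.UV` ONLY;
the YM mass gap (Clay) is NOT proved by any of this; nothing continuum ∕ ℝ⁴ ∕ OS.  No `sorry`, no `def`, no `instance`, no `notation`.

References: [15] (144) p. 300, (147)–(150) p. 301, (160) p. 303, (7) p. 278; [6] Lemma 1 (1.25) p. 79, p. 98, (1.131) p. 99; [III] (2.2) p. 255, (2.10)–(2.13) pp. 255–257;
[4] (2.1)–(2.3) p. 224.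
-/

set_option autoImplicit false

noncomputable section

open scoped BigOperators Matrix.Norms.L2Operator

namespace Summit.QuantumFields.YangMills.BalabanUVNodes.N07NearRowsAtRecordWideClass

open Literature.MathematicalPhysics.QuantumFieldTheory.Balaban1983to89
open Literature.MathematicalPhysics.QuantumFieldTheory.Balaban1983to89.Node00
open Literature.MathematicalPhysics.QuantumFieldTheory.Balaban1983to89.B15DeterminingSets
open T4Continuum (T4Family)
open T4AxialGaugeSmallField (castSite castSite_apply castSite_add_e boxPlaqs)
open B15Eq112TorusCover (cover)
open B14DomainGeom (Pt Within)
open B7Prop1Explicit (e e_apply)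
open B7Prop1Local (InBox)
open B8Eq131Cubes (box sqLo sqHi tLo tHi crad)
open B5Eq118OneStroke (iterBlockOf)
open B6SectAOperatorsV1 (BondIdx)
open GaugeField (gaugeAct)
open ExpMeanLog (expMeanLogSU deltaSU)
open MatrixLog (mlog)
open Summit.QuantumFields.Balaban3D.Carriers (radialContourData)
open Summit.QuantumFields.YangMills.Theorems.FlatCubeOpsText (Adm22)
open Summit.QuantumFields.YangMills.BalabanUVNodes.N07NormalisationOfRecordWide (NrmOfRecordWide)
open Summit.QuantumFields.YangMills.BalabanUVNodes.N07NearRowsAtRecordWide (norm_mlog_shearedAvgIter_top_le_of_data norm_mlog_shearedAvgIter_dentPair_crossing_le_of_data)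
open Summit.QuantumFields.YangMills.BalabanUVNodes.N07DentBlockDataSmall (norm_mlog_shearedAvgIter_dentBlock_within_le_of_data)
open Summit.QuantumFields.YangMills.BalabanUVNodes.N07CubeTowerInsideRecordBelowTop (near_cases_meet_both)
open Summit.QuantumFields.YangMills.BalabanUVNodes.N07RecordDomainsAdm22 (blockSat_seqOfRecord)

variable (F : T4Family) (N : ℕ) [NeZero N]

/-! ## §1  Keys: «off `Γ_j`» from «not in `Ω_j^{(j)}`»; labels of `□_j^{(j)}` and their neighbours lie in the collar box -/

/-- `Γ_j ⊆ Ω_j` in centres (`1 ≤ j ≤ k`): a level-`j` site whose centre is NOT in `Ω_j` is not in `Γ_j^{(j)} = genSet Ω k j`. [cite: Balaban1988Convergent, (2.2) p.255] -/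
theorem not_mem_genSet_of_embIter_not_mem {P : Params} (Ω : ℕ → Set (Site P 0)) {k j : ℕ} (hj1 : 1 ≤ j) (hjk : j ≤ k) {y : Site P j}
    (hy : embIter j y ∉ Ω j) : y ∉ genSet Ω k j := by
  intro h
  have h' : embIter j y ∈ gammaRegion Ω k j := h
  unfold gammaRegion at h'
  by_cases hjk' : j = k
  · subst hjk'
    rw [if_neg (lt_irrefl _), if_pos rfl] at h'
    exact hy h'
  · rw [if_neg (by omega), if_neg hjk', if_neg (by omega)] at h'
    exact hy h'.1

/-- A label of the box `[lo, hi]` lies in the one-collar box `[lo − 1, hi + 1]`. [folklore] -/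
theorem Icc_collar_of_inBox {d : ℕ} {lo hi t : Fin d → ℤ} (ht : InBox lo hi t) : t ∈ Set.Icc (lo - 1) (hi + 1) :=
  ⟨fun i => by have := (ht i).1; simp only [Pi.sub_apply, Pi.one_apply]; linarith,
   fun i => by have := (ht i).2; simp only [Pi.add_apply, Pi.one_apply]; linarith⟩

/-- … and so does its face-neighbour `t + e_μ`. [folklore] -/
theorem Icc_collar_add_e_of_inBox {d : ℕ} {lo hi t : Fin d → ℤ} (ht : InBox lo hi t) (μ : Fin d) : t + e μ ∈ Set.Icc (lo - 1) (hi + 1) := by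
  have he : ∀ i, (0 : ℤ) ≤ e μ i ∧ e μ i ≤ 1 := fun i => by rw [e_apply]; split_ifs <;> norm_num
  exact ⟨fun i => by have := (ht i).1; have := (he i).1; simp only [Pi.sub_apply, Pi.one_apply, Pi.add_apply]; linarith,
    fun i => by have := (ht i).2; have := (he i).2; simp only [Pi.add_apply, Pi.one_apply]; linarith⟩

/-! ## §2  The near rows, one theorem -/

/-- ★★★ **THE NEAR DATUM ROWS OF HCHART-MEET-NORM-77 AT THE RECORD** (statement in the header): for every cell `c` of `D″ = cubeDomains ⊓ domainsOfSeq Ω (m+1)` in print's near class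
«`j(c) = m + 1`, or both end blocks in `□_{j(c)+1}^{(j(c)+1)}`», `‖log 𝒜_{j(c)}(U^u)(c)‖` is bounded by the dent-pair crossing bound of MODULE 75 (which dominates the top and within bounds).
[cite: Balaban1985Variational, (160) p.303, (147)–(150) p.301, (7) p.278; Balaban1985RegularSpaces, Lemma 1 (1.25) p.79, p.98, (1.131) p.99; Balaban1988Convergent, (2.2), (2.10)–(2.13) pp.255–257] -/
theorem norm_mlog_shearedAvgIter_le_of_nearBoth_of_data {ν : Stage7Numerics} {M : ℕ} {g : ℕ → ℝ} {K k : ℕ} (s : SeqOfRecord F ν M g K k)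
    (hsep : Sect2.SeqSeparated ν.M₁ s) (hkK : k ≤ (F.P K).m + (F.P K).K)
    (hgrid : ∀ j : ℕ, 1 ≤ j → j ≤ k → dCubeSide (F.P K).L M (RkOfRecord (F.P K).L ν.r (g j)) j ∣ (F.P K).sitesPerDir 0)
    {Mc ρ : ℕ} (hMc : 1 ≤ Mc) (hρ : 1 ≤ ρ) (hLρ : (F.P K).L ≤ ρ) (hfloor : (11 * (F.P K).d + 4 * ρ + Mc) * (F.P K).L + 3 ≤ ν.M₁)
    {δ : ℕ → ℝ} {a₁ : ℝ} (hδ : ∀ n, n ≤ k → 0 < δ n ∧ δ n ≤ a₁) (hcompδ : ∀ n, n < k → δ n ≤ 2 * δ (n + 1))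
    (hguard : (((((F.P K).d + 2) * (F.P K).L : ℕ) : ℝ) ^ 2 / 4) * ((4 * (((((F.P K).d - 1 : ℕ) : ℝ)) * ((2 * (F.P K).L - 1 : ℕ) : ℝ)) + 1) * a₁) < deltaSU (Fin N))
    (hlog : (((F.P K).d - 1 : ℕ) : ℝ) * (crad (sideP (F.P K) Mc ρ) ρ) *
        ((1 + 2 * ((((F.P K).L : ℝ) ^ 2 + 6 * ((((F.P K).d + 2) * (F.P K).L : ℕ) : ℝ) ^ 2) * (4 * (((((F.P K).d - 1 : ℕ) : ℝ)) * ((2 * (F.P K).L - 1 : ℕ) : ℝ)) + 1))) * a₁) +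
      7 * ((((((F.P K).d + 2) * (F.P K).L : ℕ) : ℝ) ^ 2 / 4) * ((4 * (((((F.P K).d - 1 : ℕ) : ℝ)) * ((2 * (F.P K).L - 1 : ℕ) : ℝ)) + 1) * a₁)) +
      ((((F.P K).d + 1) * ((F.P K).L - 1) : ℕ) : ℝ) *
        ((((F.P K).d * ((F.P K).L - 1) + 1 : ℕ) : ℝ) * (((((F.P K).d - 1 : ℕ) : ℝ) * (((F.P K).L - 1 : ℕ) : ℝ)) * a₁)) ≤ 1 / 2)
    (W : MSField (F.P K) (SU N)) (h7 : Sect2.DataSmall7PTop (avOfRecord F N K) s.Ω (suppDomOfRecord F ν K s.Ω) k δ W)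
    (U : GaugeField (F.P K) 0 (SU N)) (hfib : AgreeOn (genSet s.Ω k) (avgFamily (avOfRecord F N K) U) W)
    {m : ℕ} (hjk : m + 1 ≤ k) (hjK : m + 1 + 1 ≤ (F.P K).m + (F.P K).K) (idx : Pt (F.P K).d)
    (hmeet : ∃ x ∈ box (F.P K).L (cornerP (F.P K) Mc ρ idx) (sideP (F.P K) Mc ρ) (m + 1), ∃ y : Pt (F.P K).d, cover (F.P K) y ∈ s.Ω (m + 1) ∧ Within ((3 : ℕ) : ℤ) x y)
    (hclean : m + 1 = k ∨ ∀ z ∈ box (F.P K).L (cornerP (F.P K) Mc ρ idx - ((2 * ρ : ℕ) : Pt (F.P K).d)) (sideP (F.P K) Mc ρ + 2 * (2 * ρ)) (m + 1),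
      cover (F.P K) z ∉ s.Ω (m + 1 + 1))
    {n₀ : ℕ} (hn : ∀ κ, (tHi (cornerP (F.P K) Mc ρ idx) (sideP (F.P K) Mc ρ) ρ) κ ≤ (tLo (cornerP (F.P K) Mc ρ idx) ρ) κ + n₀) (hnN : n₀ + 1 < (F.P K).sitesPerDir (m + 1))
    -- the normalisation of record and the (2.2) collar of `D″`
    {u : GaugeTransf (F.P K) 0 (SU N)} {A : PBond (F.P K) 0 → MatA N} (hk : m + 1 ≤ (F.P K).m + (F.P K).K)
    (hN : NrmOfRecordWide F N Mc ρ ν M g K k s U (m + 1) idx u A) {R Mb : ℕ}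
    (hAdm : Adm22 (domainsMeet (cubeDomains (F.P K) (cornerP (F.P K) Mc ρ idx) (sideP (F.P K) Mc ρ) ρ (m + 1) hk) (domainsOfSeq s.Ω (m + 1) hk)) R Mb)
    (hRM : 2 * (F.P K).L ≤ R * Mb + 1)
    -- the cell, in MODULE 77's near class
    (c : BondIdx (domainsMeet (cubeDomains (F.P K) (cornerP (F.P K) Mc ρ idx) (sideP (F.P K) Mc ρ) ρ (m + 1) hk) (domainsOfSeq s.Ω (m + 1) hk)))
    (hnear : (c.1.1 : ℕ) = m + 1 ∨
      (blockOf c.1.2.src ∈ (cubeDomains (F.P K) (cornerP (F.P K) Mc ρ idx) (sideP (F.P K) Mc ρ) ρ (m + 1) hk).Om ((c.1.1 : ℕ) + 1) ∧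
        blockOf c.1.2.tgt ∈ (cubeDomains (F.P K) (cornerP (F.P K) Mc ρ idx) (sideP (F.P K) Mc ρ) ρ (m + 1) hk).Om ((c.1.1 : ℕ) + 1))) :
    ‖mlog ((shearedAvgIter (avOfRecord F N K) (fun i => radialContourData (F.P K) i (SU N)) (loopAvgBlockOp expMeanLogSU) (gaugeAct u U) (c.1.1 : ℕ) c.1.2 : SU N) : MatA N)‖ ≤
      2 * ((((F.P K).d - 1 : ℕ) : ℝ) * (crad (sideP (F.P K) Mc ρ) ρ : ℕ) *
          ((1 + 2 * ((((F.P K).L : ℝ) ^ 2 + 6 * ((((F.P K).d + 2) * (F.P K).L : ℕ) : ℝ) ^ 2) * (4 * (((((F.P K).d - 1 : ℕ) : ℝ)) * ((2 * (F.P K).L - 1 : ℕ) : ℝ)) + 1))) * δ (m + 1)) +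
        7 * ((((((F.P K).d + 2) * (F.P K).L : ℕ) : ℝ) ^ 2 / 4) * ((4 * (((((F.P K).d - 1 : ℕ) : ℝ)) * ((2 * (F.P K).L - 1 : ℕ) : ℝ)) + 1) * δ m)) +
        ((((F.P K).d + 1) * ((F.P K).L - 1) : ℕ) : ℝ) *
          ((((F.P K).d * ((F.P K).L - 1) + 1 : ℕ) : ℝ) * (((((F.P K).d - 1 : ℕ) : ℝ) * (((F.P K).L - 1 : ℕ) : ℝ)) * δ m))) := by
  -- abbreviations and signs
  have hδj : 0 < δ (m + 1) := (hδ (m + 1) hjk).1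
  have hδm : 0 < δ m := (hδ m (by omega)).1
  have hX0 : (0 : ℝ) ≤ (((F.P K).d - 1 : ℕ) : ℝ) * (crad (sideP (F.P K) Mc ρ) ρ : ℕ) := by positivity
  have hCL0 : (0 : ℝ) ≤ 1 + 2 * ((((F.P K).L : ℝ) ^ 2 + 6 * ((((F.P K).d + 2) * (F.P K).L : ℕ) : ℝ) ^ 2) *
      (4 * (((((F.P K).d - 1 : ℕ) : ℝ)) * ((2 * (F.P K).L - 1 : ℕ) : ℝ)) + 1)) := by positivity
  have ht20 : (0 : ℝ) ≤ 7 * ((((((F.P K).d + 2) * (F.P K).L : ℕ) : ℝ) ^ 2 / 4) * ((4 * (((((F.P K).d - 1 : ℕ) : ℝ)) * ((2 * (F.P K).L - 1 : ℕ) : ℝ)) + 1) * δ m)) := by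
    positivity
  have hτ0 : (0 : ℝ) ≤ (((F.P K).d * ((F.P K).L - 1) + 1 : ℕ) : ℝ) * (((((F.P K).d - 1 : ℕ) : ℝ) * (((F.P K).L - 1 : ℕ) : ℝ)) * δ m) := by positivity
  have hdL0 : (0 : ℝ) ≤ ((((F.P K).d + 1) * ((F.P K).L - 1) : ℕ) : ℝ) := by positivity
  have hdL1 : (1 : ℝ) ≤ ((((F.P K).d + 1) * ((F.P K).L - 1) : ℕ) : ℝ) := by
    have hd : 1 ≤ (F.P K).d := (F.P K).hd
    have hL : 2 ≤ (F.P K).L := by have := (F.P K).hL.2; omega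
    have : 1 ≤ ((F.P K).d + 1) * ((F.P K).L - 1) := Nat.one_le_iff_ne_zero.mpr (Nat.mul_ne_zero (by omega) (by omega))
    exact_mod_cast this
  have hA0 : (0 : ℝ) ≤ (((F.P K).d - 1 : ℕ) : ℝ) * (crad (sideP (F.P K) Mc ρ) ρ : ℕ) *
      ((1 + 2 * ((((F.P K).L : ℝ) ^ 2 + 6 * ((((F.P K).d + 2) * (F.P K).L : ℕ) : ℝ) ^ 2) * (4 * (((((F.P K).d - 1 : ℕ) : ℝ)) * ((2 * (F.P K).L - 1 : ℕ) : ℝ)) + 1))) * δ (m + 1)) :=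
    mul_nonneg hX0 (mul_nonneg hCL0 hδj.le)
  -- the two weaker log-guards follow from the crossing one
  have ha₁ : 0 ≤ a₁ := le_trans hδm.le (hδ m (by omega)).2
  have hg2 : (0 : ℝ) ≤ 7 * ((((((F.P K).d + 2) * (F.P K).L : ℕ) : ℝ) ^ 2 / 4) * ((4 * (((((F.P K).d - 1 : ℕ) : ℝ)) * ((2 * (F.P K).L - 1 : ℕ) : ℝ)) + 1) * a₁)) := by
    positivity
  have hg3 : (0 : ℝ) ≤ (((F.P K).d * ((F.P K).L - 1) + 1 : ℕ) : ℝ) * (((((F.P K).d - 1 : ℕ) : ℝ) * (((F.P K).L - 1 : ℕ) : ℝ)) * a₁) := by positivity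
  have hg1 : (0 : ℝ) ≤ (((F.P K).d - 1 : ℕ) : ℝ) * (crad (sideP (F.P K) Mc ρ) ρ) *
      ((1 + 2 * ((((F.P K).L : ℝ) ^ 2 + 6 * ((((F.P K).d + 2) * (F.P K).L : ℕ) : ℝ) ^ 2) * (4 * (((((F.P K).d - 1 : ℕ) : ℝ)) * ((2 * (F.P K).L - 1 : ℕ) : ℝ)) + 1))) * a₁) :=
    mul_nonneg (by positivity) (mul_nonneg hCL0 ha₁)
  have hlog_top : (((F.P K).d - 1 : ℕ) : ℝ) * (crad (sideP (F.P K) Mc ρ) ρ) *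
      ((1 + 2 * ((((F.P K).L : ℝ) ^ 2 + 6 * ((((F.P K).d + 2) * (F.P K).L : ℕ) : ℝ) ^ 2) * (4 * (((((F.P K).d - 1 : ℕ) : ℝ)) * ((2 * (F.P K).L - 1 : ℕ) : ℝ)) + 1))) * a₁) ≤ 1 / 2 := by
    nlinarith [mul_nonneg hdL0 hg3]
  have hlog_within : (((F.P K).d * ((F.P K).L - 1) + 1 : ℕ) : ℝ) * (((((F.P K).d - 1 : ℕ) : ℝ) * (((F.P K).L - 1 : ℕ) : ℝ)) * a₁) ≤ 1 / 2 := by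
    have h1 : (((F.P K).d * ((F.P K).L - 1) + 1 : ℕ) : ℝ) * (((((F.P K).d - 1 : ℕ) : ℝ) * (((F.P K).L - 1 : ℕ) : ℝ)) * a₁) ≤
        ((((F.P K).d + 1) * ((F.P K).L - 1) : ℕ) : ℝ) * ((((F.P K).d * ((F.P K).L - 1) + 1 : ℕ) : ℝ) * (((((F.P K).d - 1 : ℕ) : ℝ) * (((F.P K).L - 1 : ℕ) : ℝ)) * a₁)) :=
      le_mul_of_one_le_left hg3 hdL1
    linarith
  -- the non-wrapping of `□̃` in MODULE 75's dent form
  have hnN' : ∀ κ, (tHi (cornerP (F.P K) Mc ρ idx) (sideP (F.P K) Mc ρ) ρ) κ - (tLo (cornerP (F.P K) Mc ρ idx) ρ) κ < (F.P K).sitesPerDir (m + 1) := fun κ => by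
    have := hn κ
    have h2 : ((n₀ : ℤ) + 1) < (F.P K).sitesPerDir (m + 1) := by exact_mod_cast hnN
    linarith
  -- MODULE 79's dispatch needs its floor and the meeting premise
  have hν1 : 1 ≤ ν.M₁ := by omega
  have hfl : 11 * (F.P K).d + 2 * ρ + Mc + 3 + 2 * ρ ≤ ν.M₁ := by
    have hL1 : 1 ≤ (F.P K).L := (F.P K).L_pos
    have : 11 * (F.P K).d + 4 * ρ + Mc ≤ (11 * (F.P K).d + 4 * ρ + Mc) * (F.P K).L := Nat.le_mul_of_pos_right _ hL1
    omega
  obtain ⟨x₀, hx₀, y₀, hy₀, hxy₀⟩ := hmeet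
  have hcases := near_cases_meet_both (P := F.P K) hν1 s hsep hρ hfl (by omega : 1 ≤ m + 1) hjk hk hx₀ hy₀ hxy₀ c
  -- nesting and block saturation of the run up to the datum's level (for the «off Γ» keys)
  have hnest : ∀ i : ℕ, 1 ≤ i → i < m + 1 → s.Ω (i + 1) ⊆ s.Ω i := fun i h1 hi => s.chain.Ω_succ_subset_Ω h1 (lt_of_lt_of_le hi hjk)
  have hsat : ∀ (j' : ℕ) (x x' : Site (F.P K) 0), 1 ≤ j' → j' ≤ m + 1 → iterBlockOf j' x = iterBlockOf j' x' → x ∈ s.Ω j' → x' ∈ s.Ω j' :=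
    fun j' x x' h1 hj' => blockSat_seqOfRecord F ν M g K k hkK s hgrid j' x x' h1 (hj'.trans hjk)
  have hoff : ∀ {y : Site (F.P K) (m + 1)}, y ∉ (domainsOfSeq s.Ω (m + 1) hk).Om (m + 1) → y ∉ genSet s.Ω k (m + 1) := by
    intro y hy
    refine not_mem_genSet_of_embIter_not_mem s.Ω (by omega) hjk fun hmem => hy ?_
    exact (mem_domainsOfSeq_Om_iff_centre s.Ω hk hnest hsat (by omega) le_rfl y).2 hmem
  -- destructure the cell so that its level can be substituted
  obtain ⟨⟨⟨l, hl⟩, b⟩, hb⟩ := c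
  simp only at hnear hcases hb ⊢
  rcases hcases with htop | ⟨hlev, hs, ht', hns, hnt⟩ | hfar
  · -- a TOP cell: MODULE 75's top row (any `Λ_{m+1}`-cell)
    subst htop
    have h := norm_mlog_shearedAvgIter_top_le_of_data F N s hsep hkK hgrid hMc hρ hLρ hfloor hδ hcompδ hguard hlog_top W h7 U hfib (by omega) hjk hjK idx
      ⟨x₀, hx₀, y₀, hy₀, hxy₀⟩ hclean hn hnN hk hN hAdm hRM b hb
    refine h.trans ?_
    nlinarith [mul_nonneg hdL0 hτ0]
  · -- a DENT PAIR at level `m`: labels `t` (source block) and `t` or `t + e_μ` (target block), both OFF `Γ_{m+1}`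
    have hlm : l = m := by omega
    subst hlm
    obtain ⟨t, htbox, htb⟩ := (mem_cubeDomains_Om_iff (by omega) le_rfl _).1 hs
    have hsrc : blockOf b.src = (castSite t : Site (F.P K) (l + 1)) := htb.symm
    have ht : t ∈ Set.Icc (sqLo (F.P K).L (cornerP (F.P K) Mc ρ idx) ρ (l + 1) (l + 1) - 1)
        (sqHi (F.P K).L (cornerP (F.P K) Mc ρ idx) (sideP (F.P K) Mc ρ) ρ (l + 1) (l + 1) + 1) := Icc_collar_of_inBox htbox
    have hdent : (castSite t : Site (F.P K) (l + 1)) ∉ genSet s.Ω k (l + 1) := hoff (by rw [← hsrc]; exact hns)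
    -- the target block is the source block or its face-neighbour in the bond's direction
    rcases blockOf_shift_or hk b.src b.dir with hsame | hshift
    · -- within one block: MODULE 81
      have htgt : blockOf b.tgt = (castSite t : Site (F.P K) (l + 1)) := by rw [PBond.tgt, hsame, hsrc]
      have h := norm_mlog_shearedAvgIter_dentBlock_within_le_of_data F N s hsep hkK hgrid hMc hρ hfloor hδ hlog_within W h7 U hfib hjk hjK idx
        ⟨x₀, hx₀, y₀, hy₀, hxy₀⟩ hclean t ht hdent hk hN hAdm hRM b hb hsrc htgt
      refine h.trans ?_
      have h1 : (((F.P K).d * ((F.P K).L - 1) + 1 : ℕ) : ℝ) * (((((F.P K).d - 1 : ℕ) : ℝ) * (((F.P K).L - 1 : ℕ) : ℝ)) * δ l) ≤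
          ((((F.P K).d + 1) * ((F.P K).L - 1) : ℕ) : ℝ) * ((((F.P K).d * ((F.P K).L - 1) + 1 : ℕ) : ℝ) * (((((F.P K).d - 1 : ℕ) : ℝ) * (((F.P K).L - 1 : ℕ) : ℝ)) * δ l)) :=
        le_mul_of_one_le_left hτ0 hdL1
      linarith
    · -- crossing into the neighbouring dent block `t + e_μ`: MODULE 75's crossing row
      have htgt : blockOf b.tgt = (castSite (t + e b.dir) : Site (F.P K) (l + 1)) := by rw [PBond.tgt, hshift, hsrc, castSite_add_e]
      have htμ := Icc_collar_add_e_of_inBox htbox b.dir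
      have hdentμ : (castSite (t + e b.dir) : Site (F.P K) (l + 1)) ∉ genSet s.Ω k (l + 1) := hoff (by rw [← htgt]; exact hnt)
      exact norm_mlog_shearedAvgIter_dentPair_crossing_le_of_data F N s hsep hkK hgrid hMc hρ hfloor hδ hcompδ hguard hlog W h7 U hfib hjk hjK idx
        ⟨x₀, hx₀, y₀, hy₀, hxy₀⟩ hclean hnN' t b.dir ht htμ hdent hdentμ hk hN hAdm hRM b hb hsrc rfl htgt
  · exact absurd hnear hfar

end Summit.QuantumFields.YangMills.BalabanUVNodes.N07NearRowsAtRecordWideClass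

end
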